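import Literature.MathematicalPhysics.QuantumLattice.KomaPiFluxCoulombNearestNeighbourBound
import Literature.MathematicalPhysics.QuantumLattice.KomaPiFluxSuperconductingOrder
import HarnessLib

/-!
# Koma 2022, Theorem 2.1 with the Coulomb repulsion `g' > 0` (Lieb frame)

T. Koma, *Nambu–Goldstone modes for superconducting lattice fermions*, arXiv:2201.13135 (2022)
[Koma2022], Theorem 2.1: "Let `d ≥ 3` … there exist small positive numbers `κ̂` and `ĝ'`, and a large
positive number `β_c` such that `m_LRO > 0` for `|κ|/g ≤ κ̂` and `g'/g ≤ ĝ'`, and `β ≥ β_c`."  The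
companion file `KomaPiFluxSuperconductingOrder` proves this at `g' = 0`; §8 of the paper adds the
nearest-neighbour Coulomb repulsion `H_repul = g'Σ_{bonds}Γ³_xΓ³_y` ((2.6), (8.1)): "When `g'/g` is
small, the corresponding contribution by this new interaction which appears in the double commutator in
`c_p` is small. Therefore, the long-range order still exists".  This file carries the `g'`-dependence
through (6.34)–(6.36) (`KomaPiFluxCoulombKLSInequality`, `KomaPiFluxCoulombNearestNeighbourBound`):

* `lroSq_ge_coulomb` — (6.34) for `H_C = H(κ,U;g,g',0;0)`:
  `m² ≥ E₁ - thermalSum/(βgD|Λ|) - ½√(I²_{D,Λ})√(8(κ+g')/g + 4E₁)`;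
* `nnCorr_ge_coulomb` — (6.36): `E₁ ≥ ½ - {U+2gD}₊/(2gD) - 4κ/g - 2g'/g - log 4/(βgD)`;
* **`superconductingOrder_coulomb`** — THEOREM 2.1 with the Coulomb term (this series' constants): in
  `D = d + 1 ≥ 3` directions, for `g > 0`, `0 ≤ κ ≤ g/1000`, `0 ≤ g' ≤ g/2000` and `U ≤ -2Dg`, there are
  `β₀ > 0` and `k₀` with **`lroSq β H_C ≥ 1/2000`** for all `β ≥ β₀` and all even sides `2k`, `k ≥ k₀`
  (`κ̂ = 1/1000`, `ĝ' = 1/2000` independent of the model parameters; `β₀ = 1000(log 4/(gD) + (R(D)+1)/g) + 1`).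

All statements are PROVED; no named fact.

## References

* [Koma2022] T. Koma, arXiv:2201.13135, Theorem 2.1, (6.34)–(6.36), §8 (8.1)–(8.4).
* [KLS1988PRL] T. Kennedy, E. H. Lieb, B. S. Shastry, Phys. Rev. Lett. 61 (1988) 2582, after eq. (8).
* [DLS1978] F. J. Dyson, E. H. Lieb, B. Simon, J. Stat. Phys. 18 (1978) 335, Thm. 5.1.
-/

noncomputable section

namespace Literature.MathematicalPhysics.QuantumLattice

open Matrix Finset Filter HubbardWave0 PairHopRP FermionTorus LiebCutRP
open Literature.Probability.LatticeModels

namespace KomaPiFlux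

variable {d L : ℕ} [NeZero L]

/-- **(6.34) with the Coulomb term, finite volume** (this series' constants): for
`H_C = H(κ,U;g,g',0;0)`, even `L ≥ 4`, `β > 0`, `κ, g' ≥ 0`, `g > 0`:
`m² ≥ E₁ - thermalSum/(βgD|Λ|) - ½ √(I²_{D,Λ}) √(8(κ+g')/g + 4E₁)`. [cite: Koma2022, (6.23), (6.33)–(6.34), §8] -/
theorem lroSq_ge_coulomb (hL : Even L) (h4 : 4 ≤ L) {β : ℝ} (hβ : 0 < β) {κ : ℝ} (hκ : 0 ≤ κ) (U : ℝ) {g : ℝ}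
    (hg : 0 < g) {g' : ℝ} (hg' : 0 ≤ g') :
    nnCorr β (hamiltonianC κ U g g' (fun (_ _ : FermionTorus (d + 1) L) => (0 : ℝ)) 0) -
        thermalSum d L / (β * g * ((d + 1) * (L : ℝ) ^ (d + 1))) -
        1 / 2 * Real.sqrt (idSq d L) *
          Real.sqrt (8 * (κ + g') / g + 4 * nnCorr β (hamiltonianC κ U g g' (fun (_ _ : FermionTorus (d + 1) L) => (0 : ℝ)) 0)) ≤
      lroSq β (hamiltonianC κ U g g' (fun (_ _ : FermionTorus (d + 1) L) => (0 : ℝ)) 0) := by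
  set H₀ := hamiltonianC κ U g g' (fun (_ _ : FermionTorus (d + 1) L) => (0 : ℝ)) 0 with hH₀
  have hkls := koma_kls_coulomb (d := d) hL h4 hβ hκ U hg hg'
  rw [← hH₀] at hkls
  set N₁ := ∑ i : Fin (d + 1), ∑ x : FermionTorus (d + 1) L, pairCorr β H₀ x (shift x i) with hN₁
  set Λr : ℝ := (L : ℝ) ^ (d + 1) with hΛr
  set Dr : ℝ := (d + 1 : ℝ) with hDr
  set J := ∑ q ∈ (univ : Finset (TorusSite (d + 1) L)).erase 0,
    (max (torusCosSum L q) 0) ^ 2 / dispersion (latticeMomentum L q) with hJ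
  have hΛ : 0 < Λr := by
    have : (0 : ℝ) < L := by exact_mod_cast (show 0 < L by omega)
    positivity
  have hD : 0 < Dr := by rw [hDr]; positivity
  have hcard : (Fintype.card (FermionTorus (d + 1) L) : ℝ) = Λr := by
    rw [show Fintype.card (FermionTorus (d + 1) L) = L ^ (d + 1) by
      simp only [FermionTorus, Fintype.card_lex, Fintype.card_fun, Fintype.card_fin], Nat.cast_pow]
  rw [hcard] at hkls
  have hJ0 : 0 ≤ J := Finset.sum_nonneg fun q _ => div_nonneg (sq_nonneg _) (dispersion_nonneg _)
  have hI : idSq d L = J / (Dr * Λr) := by simp only [idSq, hJ, hDr, hΛr]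
  have hE : nnCorr β H₀ = N₁ / (Dr * Λr) := by simp only [nnCorr, hN₁, hDr, hΛr]
  have hκg : 0 ≤ κ + g' := add_nonneg hκ hg'
  -- the square-root term, normalised
  have hsqrt : 1 / 2 * Real.sqrt (Λr / g * J) * Real.sqrt (Λr * (8 * (d + 1) * (κ + g') * Λr + 4 * g * N₁)) =
      Dr * Λr ^ 2 * (1 / 2 * Real.sqrt (idSq d L) * Real.sqrt (8 * (κ + g') / g + 4 * nnCorr β H₀)) := by
    have e4 : (Dr * Λr ^ 2) ^ 2 * (idSq d L * (8 * (κ + g') / g + 4 * nnCorr β H₀)) =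
        Λr / g * J * (Λr * (8 * (d + 1) * (κ + g') * Λr + 4 * g * N₁)) := by
      rw [hI, hE, hDr]
      field_simp
    calc 1 / 2 * Real.sqrt (Λr / g * J) * Real.sqrt (Λr * (8 * (d + 1) * (κ + g') * Λr + 4 * g * N₁))
        = 1 / 2 * Real.sqrt (Λr / g * J * (Λr * (8 * (d + 1) * (κ + g') * Λr + 4 * g * N₁))) := by
          rw [mul_assoc, ← Real.sqrt_mul (by positivity)]
      _ = 1 / 2 * Real.sqrt ((Dr * Λr ^ 2) ^ 2 * (idSq d L * (8 * (κ + g') / g + 4 * nnCorr β H₀))) := by rw [e4]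
      _ = 1 / 2 * (Dr * Λr ^ 2 * (Real.sqrt (idSq d L) * Real.sqrt (8 * (κ + g') / g + 4 * nnCorr β H₀))) := by
          rw [Real.sqrt_mul (sq_nonneg _), Real.sqrt_sq (by positivity), Real.sqrt_mul (idSq_nonneg d L)]
      _ = Dr * Λr ^ 2 * (1 / 2 * Real.sqrt (idSq d L) * Real.sqrt (8 * (κ + g') / g + 4 * nnCorr β H₀)) := by ring
  -- normalise the KLS inequality
  have hgoal : Dr * Λr ^ 2 * (nnCorr β H₀ - thermalSum d L / (β * g * (Dr * Λr)) -
      1 / 2 * Real.sqrt (idSq d L) * Real.sqrt (8 * (κ + g') / g + 4 * nnCorr β H₀)) ≤ Dr * Λr ^ 2 * lroSq β H₀ := by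
    have eN : Dr * Λr ^ 2 * nnCorr β H₀ = Λr * N₁ := by
      rw [hE]; field_simp
    have eT : Dr * Λr ^ 2 * (thermalSum d L / (β * g * (Dr * Λr))) = Λr / (β * g) * thermalSum d L := by
      field_simp
    rw [mul_sub, mul_sub, eN, eT, ← hsqrt]
    unfold thermalSum
    linarith [hkls]
  have hpos : 0 < Dr * Λr ^ 2 := by positivity
  exact le_of_mul_le_mul_left (by simpa only [hDr] using hgoal) hpos

/-- **(6.36) with the Coulomb term, finite volume**:
`E₁ ≥ ½ - {U + 2g(d+1)}₊/(2g(d+1)) - 4κ/g - 2g'/g - log 4/(βg(d+1))` (even `L ≥ 4`, `β > 0`, `κ, g' ≥ 0`,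
`g > 0`). [cite: Koma2022, (6.36), §8] -/
theorem nnCorr_ge_coulomb (hL : Even L) (h4 : 4 ≤ L) {β : ℝ} (hβ : 0 < β) {κ : ℝ} (hκ : 0 ≤ κ) (U : ℝ) {g : ℝ}
    (hg : 0 < g) {g' : ℝ} (hg' : 0 ≤ g') :
    1 / 2 - max (U + 2 * g * (d + 1)) 0 / (2 * g * (d + 1)) - 4 * κ / g - 2 * g' / g - Real.log 4 / (β * g * (d + 1)) ≤
      nnCorr β (hamiltonianC κ U g g' (fun (_ _ : FermionTorus (d + 1) L) => (0 : ℝ)) 0) := by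
  have h := nearestNeighbour_ge_coulomb (d := d) hL h4 hβ hκ U hg.le hg'
  have hΛ : (0 : ℝ) < (L : ℝ) ^ (d + 1) := by
    have : (0 : ℝ) < L := by exact_mod_cast (show 0 < L by omega)
    positivity
  have hD : (0 : ℝ) < (d + 1 : ℝ) := by positivity
  unfold nnCorr
  rw [le_div_iff₀ (by positivity)]
  have hid : (1 / 2 - max (U + 2 * g * (d + 1)) 0 / (2 * g * (d + 1)) - 4 * κ / g - 2 * g' / g -
      Real.log 4 / (β * g * (d + 1))) * ((d + 1) * (L : ℝ) ^ (d + 1)) =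
      (g * (d + 1) * (L : ℝ) ^ (d + 1) / 2 - max (U + 2 * g * (d + 1)) 0 * (L : ℝ) ^ (d + 1) / 2 -
        4 * (d + 1) * κ * (L : ℝ) ^ (d + 1) - 2 * g' * (d + 1) * (L : ℝ) ^ (d + 1) -
        (L : ℝ) ^ (d + 1) * Real.log 4 / β) / g := by
    field_simp
  rw [hid, div_le_iff₀ hg]
  linarith

omit [NeZero L] in
/-- `√(0.487)·√(1/2) ≤ 0.4935` (numerics of the margin). [cite: Koma2022, after (6.36)] -/
private theorem sqrt_margin_le' : Real.sqrt (487 / 1000) * Real.sqrt (1 / 2) ≤ 4935 / 10000 := by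
  rw [← Real.sqrt_mul (by norm_num), Real.sqrt_le_left (by norm_num)]
  norm_num

omit [NeZero L] in
/-- **Koma's Theorem 2.1 with the Coulomb repulsion, Lieb frame, every dimension `D = d + 1 ≥ 3`.**
For `g > 0`, `0 ≤ κ ≤ g/1000`, `0 ≤ g' ≤ g/2000` and `U + 2g(d+1) ≤ 0` (the printed model has `U = -2g(d+1)`)
there are `β₀ > 0` and `k₀` such that for every `β ≥ β₀` and every `k ≥ k₀` the Gibbs state of
`H_C = H(κ, U; g, g', h = 0; B = 0)` on the torus of side `2k` has `m² = lroSq β H_C ≥ 1/2000`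
(`κ̂ = 1/1000` and `ĝ' = 1/2000` universal; `β₀` depends on `g` and `D`).
[cite: Koma2022, Theorem 2.1, (6.34)–(6.36), §8] [cite: DLS1978, Thm. 5.1] -/
theorem superconductingOrder_coulomb (hd : 2 ≤ d) {κ U g g' : ℝ} (hg : 0 < g) (hκ : 0 ≤ κ) (hκg : κ ≤ g / 1000)
    (hg'0 : 0 ≤ g') (hg'g : g' ≤ g / 2000) (hU : U + 2 * g * (d + 1) ≤ 0) :
    ∃ β₀ : ℝ, ∃ k₀ : ℕ, 0 < β₀ ∧ ∀ β : ℝ, β₀ ≤ β → ∀ k : ℕ, k₀ ≤ k → ∀ [NeZero (2 * k)],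
      (1 / 2000 : ℝ) ≤ lroSq β (hamiltonianC κ U g g' (fun (_ _ : FermionTorus (d + 1) (2 * k)) => (0 : ℝ)) 0) := by
  obtain ⟨k₁, hk₁⟩ := idSq_eventually_le_const (d := d) hd
  obtain ⟨k₂, hk₂⟩ := thermalSum_div_eventually_le (d := d) hd
  set 𝒯 : ℝ := latticeGreen (0 : Site (d + 1)) + 1 with h𝒯
  set ℓ : ℝ := Real.log 4 / (g * (d + 1)) with hℓ
  have hD : (0 : ℝ) < (d + 1 : ℝ) := by positivity
  have hlog4 : 0 ≤ Real.log 4 := Real.log_nonneg (by norm_num)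
  have hℓ0 : 0 ≤ ℓ := by rw [hℓ]; positivity
  -- `𝒯 ≥ 0`: it dominates a thermal sum, which is nonnegative
  have h𝒯0 : 0 ≤ 𝒯 := by
    haveI : NeZero (2 * (k₂ + 1)) := ⟨by omega⟩
    refine le_trans ?_ (hk₂ (k₂ + 1) (by omega))
    refine div_nonneg (Finset.sum_nonneg fun q _ => div_nonneg (le_max_right _ _) (dispersion_nonneg _)) ?_
    positivity
  set β₀ : ℝ := 1000 * (ℓ + 𝒯 / g) + 1 with hβ₀
  have hβ₀pos : 0 < β₀ := by rw [hβ₀]; positivity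
  refine ⟨β₀, max k₁ (max k₂ 2), hβ₀pos, fun β hβ k hk _ => ?_⟩
  have hβ : 0 < β := hβ₀pos.trans_le hβ
  have hk1 : k₁ ≤ k := le_trans (le_max_left _ _) hk
  have hk2 : k₂ ≤ k := le_trans (le_max_left _ _) ((le_max_right _ _).trans hk)
  have hk2' : 2 ≤ k := le_trans (le_max_right _ _) ((le_max_right _ _).trans hk)
  set H₀ := hamiltonianC κ U g g' (fun (_ _ : FermionTorus (d + 1) (2 * k)) => (0 : ℝ)) 0 with hH₀
  -- the two finite-volume inequalities (6.34), (6.36)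
  have h34 := lroSq_ge_coulomb (d := d) (L := 2 * k) (even_two_mul k) (by omega) hβ hκ U hg hg'0
  have h36 := nnCorr_ge_coulomb (d := d) (L := 2 * k) (even_two_mul k) (by omega) hβ hκ U hg hg'0
  rw [← hH₀] at h34 h36
  rw [max_eq_right hU, zero_div, sub_zero] at h36
  -- the lattice sums
  have hI := hk₁ k hk1
  have hT := hk₂ k hk2
  set N : ℝ := ((2 * k : ℕ) : ℝ) ^ (d + 1) with hN
  have hNpos : 0 < N := by rw [hN]; positivity
  -- normalise the thermal term: `thermalSum/(βg(DN)) = (thermalSum/(DN))/(βg) ≤ 𝒯/(βg)`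
  have hTβ : thermalSum d (2 * k) / (β * g * ((d + 1) * N)) ≤ 𝒯 / (β * g) := by
    rw [show thermalSum d (2 * k) / (β * g * ((d + 1) * N)) =
        thermalSum d (2 * k) / ((d + 1) * N) / (β * g) by
      rw [div_div, mul_comm ((d + 1 : ℝ) * N)]]
    exact div_le_div_of_nonneg_right hT (by positivity)
  -- the endgame with `σ = ½ - 4κ/g - 2g'/g - ℓ/β`, `κ' = (κ + g')/g`
  set a : ℝ := κ / g with ha
  set b : ℝ := g' / g with hb
  have ha0 : 0 ≤ a := by rw [ha]; positivity
  have ha1 : a ≤ 1 / 1000 := by rw [ha, div_le_iff₀ hg]; linarith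
  have hb0 : 0 ≤ b := by rw [hb]; positivity
  have hb1 : b ≤ 1 / 2000 := by rw [hb, div_le_iff₀ hg]; linarith
  set κ' : ℝ := a + b with hκ'
  have hℓβ : Real.log 4 / (β * g * (d + 1)) = ℓ / β := by
    rw [hℓ]; field_simp
  -- `(ℓ + 𝒯/g)/β ≤ 1/1000`
  have hsmall : ℓ / β + 𝒯 / (β * g) ≤ 1 / 1000 := by
    have h1 : ℓ / β + 𝒯 / (β * g) = (ℓ + 𝒯 / g) / β := by field_simp
    rw [h1, div_le_iff₀ hβ]
    have : 1000 * (ℓ + 𝒯 / g) ≤ β := by linarith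
    linarith
  have hℓβ0 : 0 ≤ ℓ / β := by positivity
  have h𝒯β0 : 0 ≤ 𝒯 / (β * g) := by positivity
  set σ : ℝ := 1 / 2 - 4 * a - 2 * b - ℓ / β with hσ
  have h4κ : 4 * κ / g = 4 * a := by rw [ha]; ring
  have h2g' : 2 * g' / g = 2 * b := by rw [hb]; ring
  rw [h4κ, h2g', hℓβ] at h36
  have h8κ : 8 * (κ + g') / g = 8 * κ' := by rw [hκ', ha, hb]; ring
  rw [h8κ] at h34
  have hσE : σ ≤ nnCorr β H₀ := by rw [hσ]; linarith
  have hσ2 : 0 ≤ σ + 2 * κ' := by rw [hσ, hκ']; linarith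
  have hσhalf : σ + 2 * κ' ≤ 1 / 2 := by rw [hσ, hκ']; linarith
  have hIσ : idSq d (2 * k) ≤ 4 * (σ + 2 * κ') := by rw [hσ, hκ']; linarith
  have hend := lro_endgame (T := thermalSum d (2 * k) / (β * g * ((d + 1) * N))) hσ2 hIσ hσE h34
  -- `√I √(σ + 2κ') ≤ √0.487 · √(1/2) ≤ 0.4935`
  have hroot : Real.sqrt (idSq d (2 * k)) * Real.sqrt (σ + 2 * κ') ≤ 4935 / 10000 :=
    (mul_le_mul (Real.sqrt_le_sqrt hI) (Real.sqrt_le_sqrt hσhalf) (Real.sqrt_nonneg _)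
      (Real.sqrt_nonneg _)).trans sqrt_margin_le'
  rw [hσ] at hend
  linarith

omit [NeZero L] in
/-- The same, as an eventual statement along the even sides `L = 2k` (`Filter.atTop`).
[cite: Koma2022, Theorem 2.1, §8] -/
theorem superconductingOrder_coulomb_eventually (hd : 2 ≤ d) {κ U g g' : ℝ} (hg : 0 < g) (hκ : 0 ≤ κ)
    (hκg : κ ≤ g / 1000) (hg'0 : 0 ≤ g') (hg'g : g' ≤ g / 2000) (hU : U + 2 * g * (d + 1) ≤ 0) :
    ∃ β₀ : ℝ, 0 < β₀ ∧ ∀ β : ℝ, β₀ ≤ β → ∀ᶠ k : ℕ in atTop, ∀ [NeZero (2 * k)],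
      (1 / 2000 : ℝ) ≤ lroSq β (hamiltonianC κ U g g' (fun (_ _ : FermionTorus (d + 1) (2 * k)) => (0 : ℝ)) 0) := by
  obtain ⟨β₀, k₀, hβ₀, h⟩ := superconductingOrder_coulomb hd hg hκ hκg hg'0 hg'g hU
  exact ⟨β₀, hβ₀, fun β hβ => (eventually_ge_atTop k₀).mono fun k hk => h β hβ k hk⟩

end KomaPiFlux

end Literature.MathematicalPhysics.QuantumLattice

end
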